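import Summits.Ventures.PercRepro.C041SkeletonPortAdm

/-!
# THEOREM R, the reduction, the count — definitions and the converse dictionary (p6, gen 23)

Setting of `C041SkeletonPort` (mine-3, C-041.md §6 (d)).  Towards the count `Σ_{S ∈ 𝒮_sing(O)} (3g(S) − 2) = N · Φ∨`:

* `pat S : V × Bool → Bool` — the pattern formula as a function of the port NAME (so that patterns of different
  configurations live on one type); `patternOf S t = pat S t.1` definitionally;
* `AgreeBare O S` — `S` agrees with `O` on the bare edges; `portOf_congr` — the port problem depends on the bare
  edges only; the transport lemmas `weight_transport` / `pattern_transport` along an equality of problems;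
* `cluster_compl_a_subset_of_noDouble` / `_b_` — the blue cluster of a terminal is the terminal and its blue
  neighbours, now under «no vertex has blue edges to both terminals» and «the terminal edge is red» (the form the
  converse dictionary needs);
* **`DA_of_adm`** — THE CONVERSE DICTIONARY: a configuration of the singleton family whose pattern is admissible and
  valid, with the terminal edge red and no double-blue vertex, is a `(D,A)` source.
-/

namespace PercRepro

namespace MultiGraph

open Finset PortProblem

variable {V E : Type*} {G : MultiGraph V E}

section Defs

variable [Fintype V] {a b c : V} (hc : ∀ e, ¬ G.Joins e c a ∧ ¬ G.Joins e c b)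

open Classical in
/-- The pattern formula as a function of the port name. -/
noncomputable def pat (G : MultiGraph V E) (a b : V) (S : Config E) : V × Bool → Bool :=
  fun p => cond p.2 (decide (∃ e, G.Joins e p.1 b ∧ S e = true)) (decide (∃ e, G.Joins e p.1 a ∧ S e = true))

/-- `patternOf` is `pat` on the name. -/
theorem patternOf_eq_pat (S : Config E) (t : (G.portOf a b c hc S).Term) :
    G.patternOf a b c hc S t = G.pat a b S t.1 := rfl

/-- `S` agrees with `O` on the bare edges. -/
def AgreeBare (G : MultiGraph V E) (a b : V) (O S : Config E) : Prop := ∀ e, G.Bare a b e → S e = O e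

omit [Fintype V] in
/-- Red bare adjacency depends on the bare edges only. -/
theorem bareAdj_congr {O S : Config E} (h : G.AgreeBare a b O S) :
    G.BareAdj a b S = G.BareAdj a b O := by
  funext u v
  apply propext
  constructor
  · rintro ⟨e, he, hS, hj⟩
    exact ⟨e, he, (h e he) ▸ hS, hj⟩
  · rintro ⟨e, he, hO, hj⟩
    exact ⟨e, he, (h e he).symm ▸ hO, hj⟩

open Classical in
/-- **The port problem depends on the bare edges only.** -/
theorem portOf_congr {O S : Config E} (h : G.AgreeBare a b O S) :
    G.portOf a b c hc S = G.portOf a b c hc O := by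
  have h1 := bareAdj_congr (a := a) (b := b) h
  have h2 : (fun u => decide (∀ e, G.Bare a b e → G.EdgeAt e u → S e = true)) =
      fun u => decide (∀ e, G.Bare a b e → G.EdgeAt e u → O e = true) := by
    funext u
    apply decide_eq_decide.mpr
    constructor
    · intro hS e he hu
      rw [← h e he]
      exact hS e he hu
    · intro hO e he hu
      rw [h e he]
      exact hO e he hu
  unfold portOf BareReach
  simp only [h1, h2]
  rfl


omit [Fintype V] in
/-- Transport of the weight along an equality of problems. -/
theorem weight_transport {P P' : Problem V} (h : P = P') (x : P.Term → Bool) :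
    P'.weight (h ▸ x) = P.weight x := by
  subst h
  rfl

omit [Fintype V] in
/-- Transport of a pattern along an equality of problems, evaluated. -/
theorem transport_apply {P P' : Problem V} (h : P = P') (x : P.Term → Bool) (t : P'.Term) :
    (h ▸ x) t = x (h.symm ▸ t) := by
  subst h
  rfl

omit [Fintype V] in
/-- Transport of a term keeps its name. -/
theorem transport_term_fst {P P' : Problem V} (h : P = P') (t : P'.Term) :
    ((h.symm ▸ t : P.Term)).1 = t.1 := by
  subst h
  rfl

omit [Fintype V] in
/-- Transport of admissibility and validity along an equality of problems. -/
theorem adm_valid_transport {P P' : Problem V} (h : P = P') (x : P.Term → Bool) :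
    (P'.Adm (h ▸ x) ∧ (P'.X₁ (h ▸ x) ∨ P'.X₂ (h ▸ x))) ↔ (P.Adm x ∧ (P.X₁ x ∨ P.X₂ x)) := by
  subst h
  exact Iff.rfl

end Defs

section Converse

variable [Fintype V] {a b c : V} (hc : ∀ e, ¬ G.Joins e c a ∧ ¬ G.Joins e c b) {S : Config E}

/-- No vertex has blue edges to both terminals. -/
def NoDouble (G : MultiGraph V E) (a b : V) (S : Config E) : Prop :=
  ∀ u, ¬ ((∃ e, G.Joins e u a ∧ S e = false) ∧ (∃ e, G.Joins e u b ∧ S e = false))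

omit [Fintype V] in
/-- **The blue cluster of `a`, converse form**: under `Sing`, «no double-blue vertex» and «no blue edge between the
terminals», it is `a` and its blue neighbours. -/
theorem cluster_compl_a_subset_of_noDouble (hsing : G.Sing a b S) (hnd : G.NoDouble a b S)
    (hab : ∀ e, G.Joins e a b → S e = true) {v : V} (hv : v ∈ G.cluster Sᶜ a) :
    v = a ∨ ∃ e, G.Joins e v a ∧ S e = false := by
  rw [mem_cluster] at hv
  have key : ∀ v, G.Conn Sᶜ a v → v = a ∨ ∃ e, G.Joins e v a ∧ S e = false := by
    intro v hv
    unfold Conn at hv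
    induction hv with
    | refl => exact Or.inl rfl
    | @tail z v _ hzv ih =>
      obtain ⟨e', he', hj⟩ := hzv
      have hblue : S e' = false := by
        rw [compl_apply_not] at he'
        cases h : S e'
        · rfl
        · rw [h] at he'
          exact Bool.noConfusion he'
      have hjoin : G.Joins e' z v := hj
      by_cases hza : z = a
      · subst hza
        exact Or.inr ⟨e', hjoin.symm, hblue⟩
      · rcases ih with hz' | ⟨e, hez, hSe⟩
        · exact absurd hz' hza
        · have hnb : ¬ G.Bare a b e' := fun hb => by
            have := hsing z ⟨e, Or.inl hez, hSe⟩ e' hb (EdgeAt.of_joins_left hjoin)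
            rw [this] at hblue
            exact Bool.noConfusion hblue
          by_cases hv : v = a
          · exact Or.inl hv
          · exfalso
            apply hnb
            refine ⟨?_, ?_⟩
            · rintro (h1 | h1) <;> rcases hjoin with ⟨h2, h3⟩ | ⟨h2, h3⟩
              · exact hza (h2.symm.trans h1)
              · exact hv (h2.symm.trans h1)
              · exact hv (h3.symm.trans h1)
              · exact hza (h3.symm.trans h1)
            · -- `e'` at `b`: then `z = b` (a blue edge between the terminals) or `v = b` (`z` double-blue)
              rintro (h1 | h1) <;> rcases hjoin with ⟨h2, h3⟩ | ⟨h2, h3⟩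
              · -- `z = b`: the edge `e` joins `b` and `a` and is blue
                have hzb : z = b := h2.symm.trans h1
                rw [hzb] at hez
                have := hab e hez.symm
                rw [this] at hSe
                exact Bool.noConfusion hSe
              · have hvb : v = b := h2.symm.trans h1
                exact hnd z ⟨⟨e, hez, hSe⟩, ⟨e', Or.inr ⟨h2.trans hvb, h3⟩, hblue⟩⟩
              · have hvb : v = b := h3.symm.trans h1
                exact hnd z ⟨⟨e, hez, hSe⟩, ⟨e', Or.inl ⟨h2, h3.trans hvb⟩, hblue⟩⟩
              · have hzb : z = b := h3.symm.trans h1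
                rw [hzb] at hez
                have := hab e hez.symm
                rw [this] at hSe
                exact Bool.noConfusion hSe
  exact key v hv

omit [Fintype V] in
/-- **The blue cluster of `b`, converse form.** -/
theorem cluster_compl_b_subset_of_noDouble (hsing : G.Sing a b S) (hnd : G.NoDouble a b S)
    (hab : ∀ e, G.Joins e a b → S e = true) {v : V} (hv : v ∈ G.cluster Sᶜ b) :
    v = b ∨ ∃ e, G.Joins e v b ∧ S e = false := by
  rw [mem_cluster] at hv
  have key : ∀ v, G.Conn Sᶜ b v → v = b ∨ ∃ e, G.Joins e v b ∧ S e = false := by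
    intro v hv
    unfold Conn at hv
    induction hv with
    | refl => exact Or.inl rfl
    | @tail z v _ hzv ih =>
      obtain ⟨e', he', hj⟩ := hzv
      have hblue : S e' = false := by
        rw [compl_apply_not] at he'
        cases h : S e'
        · rfl
        · rw [h] at he'
          exact Bool.noConfusion he'
      have hjoin : G.Joins e' z v := hj
      by_cases hzb : z = b
      · subst hzb
        exact Or.inr ⟨e', hjoin.symm, hblue⟩
      · rcases ih with hz' | ⟨e, hez, hSe⟩
        · exact absurd hz' hzb
        · have hnb : ¬ G.Bare a b e' := fun hb => by
            have := hsing z ⟨e, Or.inr hez, hSe⟩ e' hb (EdgeAt.of_joins_left hjoin)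
            rw [this] at hblue
            exact Bool.noConfusion hblue
          by_cases hv : v = b
          · exact Or.inl hv
          · exfalso
            apply hnb
            refine ⟨?_, ?_⟩
            · rintro (h1 | h1) <;> rcases hjoin with ⟨h2, h3⟩ | ⟨h2, h3⟩
              · have hza : z = a := h2.symm.trans h1
                rw [hza] at hez
                have := hab e hez
                rw [this] at hSe
                exact Bool.noConfusion hSe
              · have hva : v = a := h2.symm.trans h1
                exact hnd z ⟨⟨e', Or.inr ⟨h2.trans hva, h3⟩, hblue⟩, ⟨e, hez, hSe⟩⟩
              · have hva : v = a := h3.symm.trans h1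
                exact hnd z ⟨⟨e', Or.inl ⟨h2, h3.trans hva⟩, hblue⟩, ⟨e, hez, hSe⟩⟩
              · have hza : z = a := h3.symm.trans h1
                rw [hza] at hez
                have := hab e hez
                rw [this] at hSe
                exact Bool.noConfusion hSe
            · rintro (h1 | h1) <;> rcases hjoin with ⟨h2, h3⟩ | ⟨h2, h3⟩
              · exact hzb (h2.symm.trans h1)
              · exact hv (h2.symm.trans h1)
              · exact hv (h3.symm.trans h1)
              · exact hzb (h3.symm.trans h1)
  exact key v hv

include hc in
open Classical in
/-- **THE CONVERSE DICTIONARY**: a configuration of the singleton family with an admissible valid pattern, a red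
terminal edge (present), no double-blue vertex and `a ≠ b` is a `(D,A)` source. -/
theorem DA_of_adm (hsing : G.Sing a b S) (hnd : G.NoDouble a b S) (hne : a ≠ b)
    (hab : ∀ e, G.Joins e a b → S e = true) (habE : ∃ e, G.Joins e a b)
    (hval : (G.portOf a b c hc S).X₁ (G.patternOf a b c hc S) ∨
      (G.portOf a b c hc S).X₂ (G.patternOf a b c hc S)) :
    (G.Conn S c a ∧ G.Conn S c b) ∧ (¬ G.Conn Sᶜ c a ∧ ¬ G.Conn Sᶜ c b ∧ ¬ G.Conn Sᶜ a b) := by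
  obtain ⟨e₀, he₀⟩ := habE
  have hca : c ≠ a := fun h => (hc e₀).2 (by rw [h]; exact he₀)
  have hcb : c ≠ b := fun h => (hc e₀).1 (by rw [h]; exact he₀.symm)
  refine ⟨?_, ?_, ?_, ?_⟩
  · exact (red_iff_X hc hca hcb ⟨e₀, he₀, hab e₀ he₀⟩).2 hval
  · intro h
    rcases cluster_compl_a_subset_of_noDouble hsing hnd hab ((G.mem_cluster).2 h.symm) with h' | ⟨e, he, _⟩
    · exact hca h'
    · exact (hc e).1 he
  · intro h
    rcases cluster_compl_b_subset_of_noDouble hsing hnd hab ((G.mem_cluster).2 h.symm) with h' | ⟨e, he, _⟩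
    · exact hcb h'
    · exact (hc e).2 he
  · intro h
    rcases cluster_compl_a_subset_of_noDouble hsing hnd hab ((G.mem_cluster).2 h) with h' | ⟨e, he, hSe⟩
    · exact hne h'.symm
    · have := hab e he.symm
      rw [this] at hSe
      exact Bool.noConfusion hSe

end Converse

end MultiGraph

end PercRepro
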